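import Summits.AtomisticToContinuum.HydrodynamicLimit.Theorems.LambertianContactSwapLambertianEulerCollisionalWindowBound
import HarnessLib

/-!
# The collisional log-heart from its research inputs: `CCW-Λ → CAT-Λ → TL1G-Λ → CollisionalOneBlockInMeanLambdaLog` (line `Sketch`, crux stmt-11854)

Support file (`--supports stmt-AtomisticToContinuum-11854`).  `collisionalOneBlockInMeanLambdaLog_of_inputs`: the clamped collisional window
large deviations under local-Gibbs restart (CCW-Λ, `…CollisionalInputs.CollisionalClampedWindowLDLambda`), the collision-activity tails along
`Λ` (CAT-Λ, `…CollisionalInputs.CollisionActivityTailsLambda`) and the Gaussian velocity tails along `Λ` (TL1G-Λ,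
`…KineticInputs.GaussianVelocityTailsLambda`) imply the collisional LOG-heart P4Λ-log (`…HeartsLog.CollisionalOneBlockInMeanLambdaLog`) —
the collisional twin of lead c7's `…KineticHeartOfInputs` (p139979), lead c8's dissection made a theorem.  Given `κ > 0` and a small tolerance
`ε`: overflow factor `R₀` and level constant `c_J` from CAT-Λ, rate scale `c₀` from CCW-Λ, clamp `V(ε) := c₀ κ |log ε|` (`eps_threshold_gauss`),
rate `γ := c₀/V` (`1/γ = κ|log ε|`), `ϑ := ε/(4t)`.  The counter-term is clamp-split on the whole interval
(`window_le_clamp_add_remainder`, remainder by TL1G-Λ through `remainder_le_of_tails`).  For `s′ − s < h₀` every piece is trivially small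
(truncated jumps by their level `c_J σ V² R₀ h₀ (N+1)`, remainder by CAT-Λ on an enclosing window through `jumpSum_mono_window`, clamped
counter-term `h₀ B_V (N+1)`, statics `C_Z h₀ (N+1)` by `…StaticsLipschitz.abs_dLZ_le`).  Otherwise `[s,s′]` is cut into `m = ⌊(s′−s)/h₀⌋`
equal windows (`jump_window_sum_eq`, `window_sum_eq`, telescoping of `dLZ`), each bounded by `…CollisionalWindowBound.window_bound`
(two-level clamp split of the jumps + entropy step with restart + CCW-Λ + CAT-Λ), summing to `κ|log ε|(s′−s)M + ε(N+1)`.  Frame plumbing: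
`…CollisionalFrame`.

Lead prover-line-stmt-AtomisticToContinuum-11854-c8-0, 2026-08-17.  [cite: Yau1991, §2] [cite: OllaVaradhanYau1993, §3]
-/

noncomputable section

namespace Summit.AtomisticToContinuum.HydrodynamicLimit.Theorems.LambertianContactSwapLambertianEulerCollisionalHeartOfInputs

open scoped BigOperators Topology ENNReal InnerProductSpace
open MeasureTheory ProbabilityTheory Filter Set InformationTheory
open Literature.MathematicalPhysics.KineticTheory
open Literature.Analysis.FluidPDE Literature.Analysis.FluidPDE.Alexander
open Literature.Analysis.FunctionSpaces
open Summit.AtomisticToContinuum.HydrodynamicLimit.Theorems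
open Summit.AtomisticToContinuum.HydrodynamicLimit.Theorems.ClampedCurrentsDockPathwise (gExp gSum DgSum)
open Summit.AtomisticToContinuum.HydrodynamicLimit.Theorems.LambertianContactSwapLambertianEulerHearts
open Summit.AtomisticToContinuum.HydrodynamicLimit.Theorems.LambertianContactSwapLambertianEulerHeartsLog
open Summit.AtomisticToContinuum.HydrodynamicLimit.Theorems.LambertianContactSwapLambertianEulerKineticInputs
open Summit.AtomisticToContinuum.HydrodynamicLimit.Theorems.LambertianContactSwapLambertianEulerCollisionalInputs
open Summit.AtomisticToContinuum.HydrodynamicLimit.Theorems.LambertianContactSwapLambertianEulerKineticWindowTools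
open Summit.AtomisticToContinuum.HydrodynamicLimit.Theorems.LambertianContactSwapLambertianEulerKineticArith
open Summit.AtomisticToContinuum.HydrodynamicLimit.Theorems.LambertianContactSwapLambertianEulerProductionSplitTools
open Summit.AtomisticToContinuum.HydrodynamicLimit.Theorems.LambertianContactSwapLambertianEulerExpectedWindowProductionTools
open Summit.AtomisticToContinuum.HydrodynamicLimit.Theorems.LambertianContactSwapLambertianEulerRestartInLaw
open Summit.AtomisticToContinuum.HydrodynamicLimit.Theorems.LambertianContactSwapLambertianEulerWindowCocycle
open Summit.AtomisticToContinuum.HydrodynamicLimit.Theorems.LambertianContactSwapLambertianEulerJumpSumTools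
open Summit.AtomisticToContinuum.HydrodynamicLimit.Theorems.LambertianContactSwapLambertianEulerStaticsLipschitz
open Summit.AtomisticToContinuum.HydrodynamicLimit.Theorems.LambertianContactSwapLambertianEulerCollisionalWindowRestart
open Summit.AtomisticToContinuum.HydrodynamicLimit.Theorems.LambertianContactSwapLambertianEulerCollisionalClampSplit
open Summit.AtomisticToContinuum.HydrodynamicLimit.Theorems.LambertianContactSwapLambertianEulerCollisionalJumpWindows
open Summit.AtomisticToContinuum.HydrodynamicLimit.Theorems.LambertianContactSwapLambertianEulerTimeLedgerStopping
open Summit.AtomisticToContinuum.HydrodynamicLimit.Theorems.LambertianContactSwapLambertianEulerCollisionalFrame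
open Summit.AtomisticToContinuum.HydrodynamicLimit.Theorems.LambertianContactSwapLambertianEulerCollisionalWindowBound

/-! ## The derivation -/

set_option maxHeartbeats 400000 in -- one declaration: the whole interval bookkeeping of the collisional heart (frame, clamp
-- splits, per-window entropy step and CAT-Λ remainder, short/long cases) exceeds the default by a small factor
/-- **THE COLLISIONAL LOG-HEART FROM ITS RESEARCH INPUTS.** `CCW-Λ → CAT-Λ → TL1G-Λ → P4Λ-log`: two-level truncation of the
compensated jumps (levels from CAT-Λ), radial clamp of the counter-terms at `V(ε) = c₀κ|log ε|`, rate `γ = c₀/V`, Gaussian remainders, equal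
macroscopic windows paid by the entropy step with restart and the clamped collisional window large deviations.
[cite: Yau1991, §2] [cite: OllaVaradhanYau1993, §3] -/
theorem collisionalOneBlockInMeanLambdaLog_of_inputs :
    CollisionalClampedWindowLDLambda → CollisionActivityTailsLambda →
    Summit.AtomisticToContinuum.HydrodynamicLimit.Theorems.LambertianContactSwapLambertianEulerKineticInputs.GaussianVelocityTailsLambda →
    CollisionalOneBlockInMeanLambdaLog := by
  intro hC hA hT r Rf hr hsol hbd hcont huniq
  obtain ⟨ηc, hηc, σc, hσc, HC⟩ := hC r Rf hr hsol hbd hcont huniq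
  obtain ⟨ηt, hηt, HA⟩ := hA r Rf hr hsol hbd hcont huniq
  obtain ⟨ηv, hηv, HT⟩ := hT
  obtain ⟨η₁, hη₁, HX⟩ := exists_Xframe r Rf hr hsol hbd hcont huniq
  obtain ⟨ηs, hηs, HJ⟩ := exists_Jframe r Rf hr hbd huniq
  obtain ⟨ηz, hηz, HZ⟩ := abs_dLZ_le r Rf hr hsol hbd hcont huniq
  set ηh : ℝ := min ηc (min ηt (min ηv (min η₁ (min ηs (min ηz (r / 2)))))) with hηh_def
  have hηh : 0 < ηh := lt_min hηc (lt_min hηt (lt_min hηv (lt_min hη₁ (lt_min hηs (lt_min hηz (by positivity))))))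
  refine ⟨ηh, hηh, fun a₀ θ₀ u₀ ha hθ hu ha0 hθ0 => ?_⟩
  obtain ⟨σt, hσt, HA⟩ := HA a₀ θ₀ u₀ ha hθ hu ha0 hθ0
  obtain ⟨σv, hσv, HT⟩ := HT a₀ θ₀ u₀ ha hθ hu ha0 hθ0
  refine ⟨min σc (min σt (min σv (1 / 2))), lt_min hσc (lt_min hσt (lt_min hσv (by norm_num))), ?_⟩
  intro σ hσ hσlt T ρ θ u hE hband Φ htie t ht
  have hσc' : σ < σc := hσlt.trans_le (min_le_left _ _)
  have hσt' : σ < σt := hσlt.trans_le ((min_le_right _ _).trans (min_le_left _ _))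
  have hσv' : σ < σv := hσlt.trans_le ((min_le_right _ _).trans ((min_le_right _ _).trans (min_le_left _ _)))
  have hσ2' : σ < 1 / 2 := hσlt.trans_le ((min_le_right _ _).trans ((min_le_right _ _).trans (min_le_right _ _)))
  have hσ2 : σ ≤ 1 / 2 := hσ2'.le
  have hσi : σ < 2⁻¹ := by rw [inv_eq_one_div]; exact hσ2'
  have hηc_le : ηh ≤ ηc := min_le_left _ _
  have hηt_le : ηh ≤ ηt := (min_le_right _ _).trans (min_le_left _ _)
  have hηv_le : ηh ≤ ηv := (min_le_right _ _).trans ((min_le_right _ _).trans (min_le_left _ _))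
  have hη1_le : ηh ≤ η₁ := (min_le_right _ _).trans ((min_le_right _ _).trans ((min_le_right _ _).trans (min_le_left _ _)))
  have hηs_le : ηh ≤ ηs := (min_le_right _ _).trans ((min_le_right _ _).trans ((min_le_right _ _).trans
    ((min_le_right _ _).trans (min_le_left _ _))))
  have hηz_le : ηh ≤ ηz := (min_le_right _ _).trans ((min_le_right _ _).trans ((min_le_right _ _).trans
    ((min_le_right _ _).trans ((min_le_right _ _).trans (min_le_left _ _)))))
  have hηr_le : ηh ≤ r / 2 := (min_le_right _ _).trans ((min_le_right _ _).trans ((min_le_right _ _).trans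
    ((min_le_right _ _).trans ((min_le_right _ _).trans (min_le_right _ _)))))
  have hb1 : ∀ {η : ℝ}, ηh ≤ η → ∀ t' ∈ Set.Ico 0 T, ∀ x, ρ t' x * σ ^ 3 < η :=
    fun hle t' ht' x => (hband t' ht' x).trans_le hle
  obtain ⟨R₀, cJ, A, a, hR₀, hcJ, hA, ha_, HA⟩ := HA σ hσ hσt' T ρ θ u hE (hb1 hηt_le) Φ htie t ht
  obtain ⟨c₀, AC, aC, hc₀, hAC, haC, HC⟩ := HC σ hσ hσc' T ρ θ u hE (hb1 hηc_le) Φ t ht R₀ hR₀ cJ hcJ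
  obtain ⟨A₂, a₂, hA₂, ha₂, HT⟩ := HT σ hσ hσv' T ρ θ u hE (hb1 hηv_le) Φ htie t ht
  obtain ⟨CZ, hCZ0, HZ⟩ := HZ hσ hσi T ρ θ u hE (hb1 hηz_le) t ht.1 ht.2
  obtain ⟨GX, CX, W, hGXm, hCX0, hW0, hGXb, hGXeq, hGXdef, hWall, hUc⟩ := HX hσ hE (hb1 hη1_le) ht.1 ht.2
  haveI hPlam : ∀ N, IsProbabilityMeasure (localGibbsLaw σ a₀ u₀ θ₀ N (Φ N)) := fun N =>
    isProbabilityMeasure_localGibbsLaw ha hθ hu ha0 hθ0 hσ2 N (Φ N)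
  have hPL : ∀ N, localGibbsLaw σ a₀ u₀ θ₀ N (Φ N) ≪ liouville (Torus.geometry (Fin 3)) (N + 1) (hsDiameter σ N) := by
    intro N; rw [localGibbsLaw, particleLaw_eq]; exact withDensity_absolutelyContinuous _ _
  obtain ⟨href, hfin⟩ := ref_frame hr hbd hcont hσ hσi ha hθ hu ha0 hθ0 hE (hb1 hηr_le) ht.2 Φ
  /- ── the log-shell: clamp level, rate, tolerances ── -/
  intro κ hκ
  have htpos : 0 < t := ht.1
  have h0t : (0 : ℝ) ≤ t := ht.1.le
  obtain ⟨ε₁, hε₁, -, Hε₁⟩ := eps_threshold_gauss (P := 4 * t * AC) haC hc₀ hκ (by positivity)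
  obtain ⟨ε₂, hε₂, -, Hε₂⟩ := eps_threshold_gauss (P := 4 * t * A) ha_ hc₀ hκ (by positivity)
  obtain ⟨ε₃, hε₃, -, Hε₃⟩ := eps_threshold_gauss (P := 4 * t * (CX * A₂)) ha₂ hc₀ hκ (by positivity)
  refine ⟨min ε₁ (min ε₂ ε₃), lt_min hε₁ (lt_min hε₂ hε₃), fun ε hε hεlt => ?_⟩
  obtain ⟨hV1, hrem1⟩ := Hε₁ ε hε (hεlt.trans_le (min_le_left _ _))
  obtain ⟨-, hrem2⟩ := Hε₂ ε hε (hεlt.trans_le ((min_le_right _ _).trans (min_le_left _ _)))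
  obtain ⟨-, hrem3⟩ := Hε₃ ε hε (hεlt.trans_le ((min_le_right _ _).trans (min_le_right _ _)))
  obtain ⟨V, hV_def⟩ : ∃ V : ℝ, V = c₀ * κ * |Real.log ε| := ⟨_, rfl⟩
  have hV1' : 1 ≤ V := by rw [hV_def]; exact hV1
  have hVpos : 0 < V := one_pos.trans_le hV1'
  have hV0 : 0 ≤ V := hVpos.le
  obtain ⟨γ, hγ_def⟩ : ∃ γ : ℝ, γ = c₀ / V := ⟨_, rfl⟩
  have hγ : 0 < γ := by rw [hγ_def]; exact div_pos hc₀ hVpos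
  have hCγ : 1 / γ = κ * |Real.log ε| := by
    rw [hγ_def, one_div, inv_div, hV_def]; field_simp
  refine ⟨κ * |Real.log ε|, by positivity, le_rfl, ?_⟩
  have hG1 : t * AC * Real.exp (-(aC * V ^ 2)) ≤ ε / 12 := by
    have h := hrem1; rw [← hV_def] at h; linarith only [h]
  have hG2 : t * A * Real.exp (-(a * V ^ 2)) ≤ ε / 12 := by
    have h := hrem2; rw [← hV_def] at h; linarith only [h]
  have hG3 : t * (CX * A₂) * Real.exp (-(a₂ * V ^ 2)) ≤ ε / 12 := by
    have h := hrem3; rw [← hV_def] at h; linarith only [h]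
  have hexp1 : Real.exp (-(a * V ^ 2)) ≤ 1 := Real.exp_le_one_iff.2 (neg_nonpos.2 (mul_nonneg ha_.le (sq_nonneg V)))
  have hϑ : 0 < ε / (4 * t) := by positivity
  obtain ⟨w₀, hw₀, HCw⟩ := HC V hV1' γ hγ (by rw [hγ_def]) (ε / (4 * t)) hϑ
  obtain ⟨GXV, hGXV⟩ : ∃ GXV : ℝ × (T3 × V3) → ℝ,
      GXV = fun q => if ‖q.2.2 - u (max 0 (min q.1 t)) q.2.1‖ ≤ V then GX q else 0 := ⟨_, rfl⟩
  obtain ⟨BXV, hBXV_def⟩ : ∃ BXV : ℝ, BXV = CX * (1 + V + W) ^ 3 := ⟨_, rfl⟩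
  have hBXV : 0 ≤ BXV := by rw [hBXV_def]; positivity
  have hGXVb0 : ∀ q, |GXV q| ≤ CX * (1 + V + W) ^ 3 := by
    intro q
    simp only [hGXV]
    split_ifs with h
    · have hv : ‖q.2.2‖ ≤ V + W := by
        have h1 := norm_le_norm_sub_add q.2.2 (u (max 0 (min q.1 t)) q.2.1)
        linarith only [h1, h, hWall q.1 q.2.1]
      calc |GX q| ≤ CX * (1 + ‖q.2.2‖) ^ 3 := hGXb q
        _ ≤ CX * (1 + V + W) ^ 3 :=
            mul_le_mul_of_nonneg_left (pow_le_pow_left₀ (by positivity) (by linarith only [hv]) 3) hCX0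
    · rw [abs_zero]; positivity
  have hGXVb : ∀ q, |GXV q| ≤ BXV := fun q => (hGXVb0 q).trans_eq hBXV_def.symm
  have hGXVm : Measurable GXV := by rw [hGXV]; exact measurable_clampObs hGXm hUc V
  have hGXVeq : ∀ r' ∈ Set.Icc 0 t, ∀ y : T3 × V3, GXV (r', y) = XcolClamp V σ ρ θ u r' y := by
    intro r' hr' y
    have hc : max 0 (min r' t) = r' := by rw [min_eq_left hr'.2, max_eq_right hr'.1]
    simp only [hGXV, XcolClamp, hGXeq r' hr', hc]
  obtain ⟨Q, hQ_def⟩ : ∃ Q : ℝ, Q = cJ * σ * V ^ 2 * R₀ + A + BXV + CZ := ⟨_, rfl⟩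
  have hQ0 : 0 ≤ Q := by rw [hQ_def]; positivity
  obtain ⟨h₀, hh₀_def⟩ : ∃ h₀ : ℝ, h₀ = min w₀ (min t (ε / (4 * Q + 4))) := ⟨_, rfl⟩
  have hh₀ : 0 < h₀ := by
    rw [hh₀_def]
    exact lt_min hw₀ (lt_min htpos (div_pos hε (by linarith only [hQ0])))
  have hh₀w : h₀ ≤ w₀ := by rw [hh₀_def]; exact min_le_left _ _
  have hh₀t : h₀ ≤ t := by rw [hh₀_def]; exact (min_le_right _ _).trans (min_le_left _ _)
  have hh₀Q : h₀ * Q ≤ ε / 4 := by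
    have h2 : 0 < 4 * Q + 4 := by linarith only [hQ0]
    have h1 : h₀ ≤ ε / (4 * Q + 4) := by rw [hh₀_def]; exact (min_le_right _ _).trans (min_le_right _ _)
    have h1' : h₀ * (4 * Q + 4) ≤ ε := (le_div_iff₀ h2).1 h1
    have h3 : h₀ * (4 * Q + 4) = 4 * (h₀ * Q) + 4 * h₀ := by ring
    linarith only [h1', h3, hh₀.le]
  obtain ⟨N₁, HC1⟩ := HCw h₀ hh₀ hh₀w
  obtain ⟨N₂, HA2⟩ := HA V hV1' h₀ hh₀
  obtain ⟨N₃, HT3⟩ := HT V hV1'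
  refine ⟨max N₁ (max N₂ N₃), fun N hN s s' M hs hss' hs't hM => ?_⟩
  have hN₁ : N₁ ≤ N := (le_max_left _ _).trans hN
  have hN₂ : N₂ ≤ N := ((le_max_left _ _).trans (le_max_right _ _)).trans hN
  have hN₃ : N₃ ≤ N := ((le_max_right _ _).trans (le_max_right _ _)).trans hN
  have hn : (0 : ℝ) < (N : ℝ) + 1 := by positivity
  have hsI : s ∈ Set.Icc s s' := ⟨le_rfl, hss'⟩
  have hM0 : 0 ≤ M := ENNReal.toReal_nonneg.trans (hM s hsI)
  have hL0 : 0 ≤ s' - s := sub_nonneg.2 hss'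
  have hs'0 : 0 ≤ s' := hs.trans hss'
  have hIcc : Set.Icc s s' ⊆ Set.Icc 0 t := fun r' hr' => ⟨hs.trans hr'.1, hr'.2.trans hs't⟩
  have hacc : ∀ᵐ p ∂((localGibbsLaw σ a₀ u₀ θ₀ N (Φ N)).prod (lambertNoise (Fin 3))), ∀ T' : ℝ, ∃ k,
      ENNReal.ofReal T' < lambertInstant (Torus.geometry (Fin 3)) (hsDiameter σ N) p.2 p.1 k :=
    ae_nonAccumulation_of_absolutelyContinuous hσ hσi N _ (hPL N)
  -- the compensated jump of this `N`, clamped in time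
  obtain ⟨Jc, D, hJcm, hD0, hJcD, hJc_inv, hJcdef, hJceq⟩ := HJ hσ hσi hE (hb1 hηs_le) ht.1 ht.2 N
  -- the per-contact level and the extensive identity
  have hℓ : 0 ≤ jumpLevel σ N cJ V := by
    unfold jumpLevel; exact mul_nonneg (mul_nonneg hcJ.le (hsDiameter_pos hσ N).le) (sq_nonneg _)
  have hR₀0 : 0 ≤ R₀ := zero_le_one.trans hR₀
  have hlevel : ∀ h : ℝ, jumpLevel σ N cJ V * (R₀ * h * ((N : ℝ) + 1) ^ (4 / 3 : ℝ)) =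
      (cJ * σ * V ^ 2 * R₀ * h) * ((N : ℝ) + 1) := fun h => jumpLevel_mul_window σ N cJ V R₀ h
  /- ── (B) the counter-term: clamp split on `[s, s′]` and the Gaussian-tail remainder ── -/
  have hXsplit := window_le_clamp_add_remainder hσ hσi ha hθ hu ha0 hθ0 (Φ N) hGXm hss' hCX0
    (fun r' _ y => hGXb (r', y)) hUc V
  have hremD : ∀ r' ∈ Set.Icc s s',
      ∫ p, (∑ i, (if V < ‖(lambertFlow (Torus.geometry (Fin 3)) (hsDiameter σ N) p.2 p.1 r' i).2 -
          (fun p : ℝ × T3 => u (max 0 (min p.1 t)) p.2) (r', (lambertFlow (Torus.geometry (Fin 3)) (hsDiameter σ N) p.2 p.1 r' i).1)‖ then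
          (1 + ‖(lambertFlow (Torus.geometry (Fin 3)) (hsDiameter σ N) p.2 p.1 r' i).2‖) ^ 3 else 0)) ∂((localGibbsLaw σ a₀ u₀ θ₀ N (Φ N)).prod (lambertNoise (Fin 3))) ≤
        A₂ * Real.exp (-(a₂ * V ^ 2)) * ((N : ℝ) + 1) := by
    intro r' hr'
    have h := HT3 N hN₃ r' (hIcc hr')
    have hc : max 0 (min r' t) = r' := by rw [min_eq_left (hIcc hr').2, max_eq_right (hIcc hr').1]
    simp only [hc]
    exact h
  have hXrem := remainder_le_of_tails hσ hσi ha hθ hu ha0 hθ0 (Φ N) hGXm hss' hCX0 (fun r' _ y => hGXb (r', y)) hUc V hremD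
  have hXrem' : (s' - s) * (CX * (A₂ * Real.exp (-(a₂ * V ^ 2)) * ((N : ℝ) + 1))) ≤ ε / 12 * ((N : ℝ) + 1) := by
    have e : (s' - s) * (CX * (A₂ * Real.exp (-(a₂ * V ^ 2)) * ((N : ℝ) + 1))) =
        ((s' - s) * (CX * A₂) * Real.exp (-(a₂ * V ^ 2))) * ((N : ℝ) + 1) := by ring
    rw [e]
    refine mul_le_mul_of_nonneg_right ?_ hn.le
    have hX : 0 ≤ (CX * A₂) * Real.exp (-(a₂ * V ^ 2)) := by positivity
    calc (s' - s) * (CX * A₂) * Real.exp (-(a₂ * V ^ 2)) = (s' - s) * ((CX * A₂) * Real.exp (-(a₂ * V ^ 2))) := by ring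
      _ ≤ t * ((CX * A₂) * Real.exp (-(a₂ * V ^ 2))) := mul_le_mul_of_nonneg_right (by linarith only [hs, hs't]) hX
      _ = t * (CX * A₂) * Real.exp (-(a₂ * V ^ 2)) := by ring
      _ ≤ ε / 12 := hG3
  -- the clamped counter-term functional in the two syntactic forms
  have hformV : ∀ (a' b : ℝ),
      (∫ p, (∫ r' in a'..b, ∑ i, (if ‖(lambertFlow (Torus.geometry (Fin 3)) (hsDiameter σ N) p.2 p.1 r' i).2 -
          (fun p : ℝ × T3 => u (max 0 (min p.1 t)) p.2) (r', (lambertFlow (Torus.geometry (Fin 3)) (hsDiameter σ N) p.2 p.1 r' i).1)‖ ≤ V then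
          GX (r', lambertFlow (Torus.geometry (Fin 3)) (hsDiameter σ N) p.2 p.1 r' i) else 0)) ∂((localGibbsLaw σ a₀ u₀ θ₀ N (Φ N)).prod (lambertNoise (Fin 3)))) =
      ∫ p, (∫ r' in a'..b, ∑ i, GXV (r', lambertFlow (Torus.geometry (Fin 3)) (hsDiameter σ N) p.2 p.1 r' i)) ∂((localGibbsLaw σ a₀ u₀ θ₀ N (Φ N)).prod (lambertNoise (Fin 3))) :=
    fun a' b => by rw [hGXV]
  rw [hformV s s'] at hXsplit
  /- ── (F) the two cases ── -/
  rw [Jmp_eq_clamped hσ hσi N (Φ N) hJceq hs hss' hs't, Xint_eq_clamped (σ := σ) N (Φ N) hGXeq hs hss' hs't]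
  by_cases hLh : s' - s < h₀
  · /- SHORT INTERVAL: every piece is trivially small -/
    -- an enclosing window `[aw, aw + h₀] ⊆ [0, t]` with `aw ≤ s`, `s' ≤ aw + h₀`
    obtain ⟨aw, haw0, haws, hs'aw, hawt⟩ : ∃ aw : ℝ, 0 ≤ aw ∧ aw ≤ s ∧ s' ≤ aw + h₀ ∧ aw + h₀ ≤ t := by
      by_cases hst : s + h₀ ≤ t
      · exact ⟨s, hs, le_rfl, by linarith only [hLh], hst⟩
      · push Not at hst
        exact ⟨t - h₀, by linarith only [hh₀t], by linarith only [hst], by linarith only [hs't], by linarith only [hh₀]⟩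
    have hM' : 0 ≤ R₀ * h₀ * ((N : ℝ) + 1) ^ (4 / 3 : ℝ) := by positivity
    -- (1) jumps: clamp split with the window threshold of length `h₀`
    have hJsplit := neg_jumpSum_le_trunc_add_remainder hσ hσi ha hθ hu ha0 hθ0 (Φ N) hJcm hD0 hJcD hℓ hM' hs hss'
    have hTL := abs_integral_truncSum_le (σ := σ) N ((localGibbsLaw σ a₀ u₀ θ₀ N (Φ N)).prod (lambertNoise (Fin 3))) Jc (jumpLevel σ N cJ V)
      (L := jumpLevel σ N cJ V * (R₀ * h₀ * ((N : ℝ) + 1) ^ (4 / 3 : ℝ))) (mul_nonneg hℓ hM') s s'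
    have hLe := hlevel h₀
    -- the remainder on `(s, s']` is dominated by the remainder on the enclosing window
    have hcat := cat_remainder_le hσ hσi ha hθ hu ha0 hθ0 N (Φ N) hJcm hD0 hJcD hJceq hℓ hA.le hh₀ (HA2 N hN₂) haw0 le_rfl
      (by linarith only [hh₀]) hawt
    have hJexc : Measurable fun q : ℝ × Config (N + 1) (Fin 3) T3 => max (|Jc q| - jumpLevel σ N cJ V) 0 :=
      ((measurable_abs.comp hJcm).sub measurable_const).max measurable_const
    have hJexcD : ∀ q : ℝ × Config (N + 1) (Fin 3) T3, |max (|Jc q| - jumpLevel σ N cJ V) 0| ≤ D * (1 + configEnergy q.2) := by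
      intro q
      rw [abs_of_nonneg (le_max_right _ _)]
      exact (max_le (by linarith only [hℓ]) (abs_nonneg _)).trans (hJcD q)
    have hIR1 := integrable_jumpSum hσ hσi ha hθ hu ha0 hθ0 N (Φ N) hJexc hD0 hJexcD s s' hs'0
    have hIR1w := integrable_jumpSum hσ hσi ha hθ hu ha0 hθ0 N (Φ N) hJexc hD0 hJexcD aw (aw + h₀) (by linarith only [haw0, hh₀])
    have hKs' := integrable_lambertCount_real hσ hσi ha hθ hu ha0 hθ0 (Φ N) hs'0
    have hKs := integrable_lambertCount_real hσ hσi ha hθ hu ha0 hθ0 (Φ N) hs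
    have hKw := integrable_lambertCount_real hσ hσi ha hθ hu ha0 hθ0 (Φ N) (show 0 ≤ aw + h₀ by linarith only [haw0, hh₀])
    have hKaw := integrable_lambertCount_real hσ hσi ha hθ hu ha0 hθ0 (Φ N) haw0
    have hmaxI : ∀ {f : Config (N + 1) (Fin 3) T3 × (ℕ → V3) → ℝ}, Integrable f ((localGibbsLaw σ a₀ u₀ θ₀ N (Φ N)).prod (lambertNoise (Fin 3))) → Integrable (fun p => max (f p) 0) ((localGibbsLaw σ a₀ u₀ θ₀ N (Φ N)).prod (lambertNoise (Fin 3))) := by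
      intro f hf
      refine hf.abs.mono' (hf.aestronglyMeasurable.aemeasurable.max aemeasurable_const).aestronglyMeasurable
        (Eventually.of_forall fun p => ?_)
      rw [Real.norm_eq_abs, abs_of_nonneg (le_max_right _ _)]
      exact max_le (le_abs_self _) (abs_nonneg _)
    have hIR2 := hmaxI ((((hKs'.sub hKs).sub (integrable_const (R₀ * h₀ * ((N : ℝ) + 1) ^ (4 / 3 : ℝ)))).const_mul
      (jumpLevel σ N cJ V)))
    have hIR2w := hmaxI ((((hKw.sub hKaw).sub (integrable_const (R₀ * h₀ * ((N : ℝ) + 1) ^ (4 / 3 : ℝ)))).const_mul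
      (jumpLevel σ N cJ V)))
    have hmono : (∫ p, ((∑ m ∈ Finset.range (lambertCount (Torus.geometry (Fin 3)) (hsDiameter σ N) p.2 p.1 s'),
          if s < (lambertInstant (Torus.geometry (Fin 3)) (hsDiameter σ N) p.2 p.1 (m + 1)).toReal then
            max (|Jc ((lambertInstant (Torus.geometry (Fin 3)) (hsDiameter σ N) p.2 p.1 (m + 1)).toReal,
              lambertStateAfter (Torus.geometry (Fin 3)) (hsDiameter σ N) p.2 p.1 m)| - jumpLevel σ N cJ V) 0 else 0) +
          max (jumpLevel σ N cJ V * (((lambertCount (Torus.geometry (Fin 3)) (hsDiameter σ N) p.2 p.1 s' : ℝ) -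
            (lambertCount (Torus.geometry (Fin 3)) (hsDiameter σ N) p.2 p.1 s : ℝ)) - R₀ * h₀ * ((N : ℝ) + 1) ^ (4 / 3 : ℝ))) 0) ∂((localGibbsLaw σ a₀ u₀ θ₀ N (Φ N)).prod (lambertNoise (Fin 3)))) ≤
        ∫ p, ((∑ m ∈ Finset.range (lambertCount (Torus.geometry (Fin 3)) (hsDiameter σ N) p.2 p.1 (aw + h₀)),
          if aw < (lambertInstant (Torus.geometry (Fin 3)) (hsDiameter σ N) p.2 p.1 (m + 1)).toReal then
            max (|Jc ((lambertInstant (Torus.geometry (Fin 3)) (hsDiameter σ N) p.2 p.1 (m + 1)).toReal,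
              lambertStateAfter (Torus.geometry (Fin 3)) (hsDiameter σ N) p.2 p.1 m)| - jumpLevel σ N cJ V) 0 else 0) +
          max (jumpLevel σ N cJ V * (((lambertCount (Torus.geometry (Fin 3)) (hsDiameter σ N) p.2 p.1 (aw + h₀) : ℝ) -
            (lambertCount (Torus.geometry (Fin 3)) (hsDiameter σ N) p.2 p.1 aw : ℝ)) - R₀ * h₀ * ((N : ℝ) + 1) ^ (4 / 3 : ℝ))) 0) ∂((localGibbsLaw σ a₀ u₀ θ₀ N (Φ N)).prod (lambertNoise (Fin 3))) := by
      refine integral_mono_ae (hIR1.add hIR2) (hIR1w.add hIR2w) ?_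
      filter_upwards [hacc] with p hp
      have hZ := hp (aw + h₀)
      refine add_le_add ?_ ?_
      · exact jumpSum_mono_window (G := Torus.geometry (Fin 3)) (ε := hsDiameter σ N)
          (fun q => max (|Jc q| - jumpLevel σ N cJ V) 0) (fun q => le_max_right _ _) haw0 haws hss' hs'aw hZ
      · refine max_le_max_right 0 (mul_le_mul_of_nonneg_left (sub_le_sub_right (sub_le_sub ?_ ?_) _) hℓ)
        · exact_mod_cast lambertCount_mono_of_le hZ hs'aw
        · exact_mod_cast lambertCount_mono_of_le (hZ.imp fun k hk => (ENNReal.ofReal_le_ofReal (by linarith only [hss', hs'aw])).trans_lt hk) haws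
    -- (2) the clamped counter-term and the statics on the short interval
    have hXV := abs_window_le hσ2 ha hθ hu ha0 hθ0 (Φ N) hGXVb hss'
    have hZs := HZ N s s' hs hss' hs't
    -- (3) bookkeeping
    have h1 : (s' - s) * (((N : ℝ) + 1) * BXV) ≤ h₀ * BXV * ((N : ℝ) + 1) :=
      calc (s' - s) * (((N : ℝ) + 1) * BXV) ≤ h₀ * (((N : ℝ) + 1) * BXV) :=
            mul_le_mul_of_nonneg_right hLh.le (by positivity)
        _ = h₀ * BXV * ((N : ℝ) + 1) := by ring
    have h2 : CZ * (s' - s) * ((N : ℝ) + 1) ≤ CZ * h₀ * ((N : ℝ) + 1) := by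
      have : CZ * (s' - s) ≤ CZ * h₀ := mul_le_mul_of_nonneg_left hLh.le hCZ0
      exact mul_le_mul_of_nonneg_right this hn.le
    have h3 : A * Real.exp (-(a * V ^ 2)) * h₀ * ((N : ℝ) + 1) ≤ A * h₀ * ((N : ℝ) + 1) := by
      have hAe : A * Real.exp (-(a * V ^ 2)) ≤ A := mul_le_of_le_one_right hA.le hexp1
      exact mul_le_mul_of_nonneg_right (mul_le_mul_of_nonneg_right hAe hh₀.le) hn.le
    have h4 : h₀ * Q * ((N : ℝ) + 1) ≤ ε / 4 * ((N : ℝ) + 1) := mul_le_mul_of_nonneg_right hh₀Q hn.le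
    have hQe : h₀ * Q * ((N : ℝ) + 1) = (cJ * σ * V ^ 2 * R₀ * h₀) * ((N : ℝ) + 1) + A * h₀ * ((N : ℝ) + 1) +
        h₀ * BXV * ((N : ℝ) + 1) + CZ * h₀ * ((N : ℝ) + 1) := by rw [hQ_def]; ring
    have h5 : 0 ≤ κ * |Real.log ε| * (s' - s) * M := by positivity
    have hεn : 0 ≤ ε * ((N : ℝ) + 1) := by positivity
    have hXVle := (abs_le.1 hXV).2
    have hZle := (abs_le.1 hZs).2
    have hTLle := (abs_le.1 hTL).1
    linarith only [hJsplit, hmono, hcat, hXsplit, hXrem, hXrem', hXVle, hZle, hTLle, hLe, h1, h2, h3, h4, hQe, h5, hεn]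
  · /- LONG INTERVAL: `m` equal windows of length `hw ∈ [h₀, 2h₀]` -/
    push Not at hLh
    obtain ⟨m, hm1, hmlo, hmhi⟩ := window_count hh₀ hLh
    have hm0 : m ≠ 0 := Nat.one_le_iff_ne_zero.1 hm1
    have hmpos : (0 : ℝ) < m := by exact_mod_cast Nat.pos_of_ne_zero hm0
    obtain ⟨hw, hhw_def⟩ : ∃ hw : ℝ, hw = (s' - s) / m := ⟨_, rfl⟩
    have hmlo' : h₀ ≤ hw := by rw [hhw_def]; exact hmlo
    have hmhi' : hw ≤ 2 * h₀ := by rw [hhw_def]; exact hmhi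
    have hhw0 : 0 < hw := hh₀.trans_le hmlo'
    have hmhw : (m : ℝ) * hw = s' - s := by rw [hhw_def]; field_simp
    -- additivity of the three functionals over the windows
    rw [jump_window_sum_eq hσ hσi ha hθ hu ha0 hθ0 (Φ N) hJcm hD0 hJcD hs hss' hm0]
    have hdLZ : dLZ σ Rf ρ N s s' = ∑ k ∈ Finset.range m, dLZ σ Rf ρ N (s + k * ((s' - s) / m)) (s + (k + 1) * ((s' - s) / m)) := by
      have htel : ∀ j : ℕ, ∑ k ∈ Finset.range j, dLZ σ Rf ρ N (s + k * ((s' - s) / m)) (s + (k + 1) * ((s' - s) / m)) =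
          dLZ σ Rf ρ N s (s + j * ((s' - s) / m)) := by
        intro j
        induction j with
        | zero => simp [dLZ]
        | succ j ih =>
          rw [Finset.sum_range_succ, ih]
          unfold dLZ
          push_cast
          ring
      rw [htel m]
      congr 1
      rw [← hhw_def]; linarith only [hmhw]
    have hXVsum := window_sum_eq hσ hσi ha hθ hu ha0 hθ0 (Φ N) hGXVm hGXVb hss' hm0
    rw [hXVsum] at hXsplit
    rw [hdLZ]
    -- per-window bound
    have hwin : ∀ k ∈ Finset.range m,
        -(∫ p, (∑ n ∈ Finset.range (lambertCount (Torus.geometry (Fin 3)) (hsDiameter σ N) p.2 p.1 (s + (k + 1) * ((s' - s) / m))),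
            if s + k * ((s' - s) / m) < (lambertInstant (Torus.geometry (Fin 3)) (hsDiameter σ N) p.2 p.1 (n + 1)).toReal then
              Jc ((lambertInstant (Torus.geometry (Fin 3)) (hsDiameter σ N) p.2 p.1 (n + 1)).toReal,
                lambertStateAfter (Torus.geometry (Fin 3)) (hsDiameter σ N) p.2 p.1 n) else 0) ∂((localGibbsLaw σ a₀ u₀ θ₀ N (Φ N)).prod (lambertNoise (Fin 3)))) +
          (∫ p, (∫ r' in (s + k * ((s' - s) / m))..(s + (k + 1) * ((s' - s) / m)),
            ∑ i, GXV (r', lambertFlow (Torus.geometry (Fin 3)) (hsDiameter σ N) p.2 p.1 r' i)) ∂((localGibbsLaw σ a₀ u₀ θ₀ N (Φ N)).prod (lambertNoise (Fin 3)))) +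
          dLZ σ Rf ρ N (s + k * ((s' - s) / m)) (s + (k + 1) * ((s' - s) / m)) ≤
        hw / γ * M + hw * (ε / (4 * t) + AC * Real.exp (-(aC * V ^ 2)) + A * Real.exp (-(a * V ^ 2))) * ((N : ℝ) + 1) := by
      intro k hk
      have hklt : (k : ℝ) + 1 ≤ m := by exact_mod_cast Nat.succ_le_of_lt (Finset.mem_range.1 hk)
      have hk0 : (0 : ℝ) ≤ k := Nat.cast_nonneg k
      obtain ⟨aw, haw_def⟩ : ∃ aw : ℝ, aw = s + k * hw := ⟨_, rfl⟩
      have haws : s ≤ aw := by rw [haw_def]; exact le_add_of_nonneg_right (mul_nonneg hk0 hhw0.le)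
      have haw0 : 0 ≤ aw := hs.trans haws
      have hawh : aw + hw ≤ s' := by
        have e1 : aw + hw = s + ((k : ℝ) + 1) * hw := by rw [haw_def]; ring
        have e2 : ((k : ℝ) + 1) * hw ≤ (m : ℝ) * hw := mul_le_mul_of_nonneg_right hklt hhw0.le
        rw [e1]
        linarith only [e2, hmhw]
      have e : s + ((k : ℝ) + 1) * ((s' - s) / m) = aw + hw := by rw [haw_def, hhw_def]; ring
      have e0 : s + (k : ℝ) * ((s' - s) / m) = aw := by rw [haw_def, hhw_def]
      rw [e, e0]
      exact window_bound hσ hσi hσ2 ha hθ hu ha0 hθ0 N (Φ N) href (hfin N) hJcm hD0 hJcD hJc_inv hJceq hGXVm hBXV hGXVb hGXVeq hcJ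
        hR₀0 hA.le hγ hh₀ (HA2 N hN₂) (HC1 N hN₁) hs't hM haw0 hmlo' hmhi' hawh haws
    have hγ0 : γ ≠ 0 := hγ.ne'
    have ht0 : t ≠ 0 := htpos.ne'
    have halg : (m : ℝ) * (hw / γ * M + hw * (ε / (4 * t) + AC * Real.exp (-(aC * V ^ 2)) + A * Real.exp (-(a * V ^ 2))) *
        ((N : ℝ) + 1)) = κ * |Real.log ε| * (s' - s) * M +
        ((s' - s) * (ε / (4 * t)) + (s' - s) * (AC * Real.exp (-(aC * V ^ 2))) + (s' - s) * (A * Real.exp (-(a * V ^ 2)))) *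
          ((N : ℝ) + 1) := by
      rw [← hmhw, ← hCγ]
      field_simp
    have hsumle0 := Finset.sum_le_sum hwin
    rw [Finset.sum_add_distrib, Finset.sum_add_distrib, Finset.sum_neg_distrib, Finset.sum_const, Finset.card_range,
      nsmul_eq_mul] at hsumle0
    have hsumle := hsumle0.trans_eq halg
    have hst : s' - s ≤ t := by linarith only [hs, hs't]
    have e1 : (s' - s) * (ε / (4 * t)) ≤ ε / 4 :=
      calc (s' - s) * (ε / (4 * t)) ≤ t * (ε / (4 * t)) := mul_le_mul_of_nonneg_right hst hϑ.le
        _ = ε / 4 := by field_simp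
    have e2 : (s' - s) * (AC * Real.exp (-(aC * V ^ 2))) ≤ ε / 12 :=
      calc (s' - s) * (AC * Real.exp (-(aC * V ^ 2))) ≤ t * (AC * Real.exp (-(aC * V ^ 2))) :=
            mul_le_mul_of_nonneg_right hst (by positivity)
        _ = t * AC * Real.exp (-(aC * V ^ 2)) := by ring
        _ ≤ ε / 12 := hG1
    have e3 : (s' - s) * (A * Real.exp (-(a * V ^ 2))) ≤ ε / 12 :=
      calc (s' - s) * (A * Real.exp (-(a * V ^ 2))) ≤ t * (A * Real.exp (-(a * V ^ 2))) :=
            mul_le_mul_of_nonneg_right hst (by positivity)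
        _ = t * A * Real.exp (-(a * V ^ 2)) := by ring
        _ ≤ ε / 12 := hG2
    have e4 := mul_le_mul_of_nonneg_right (add_le_add (add_le_add e1 e2) e3) hn.le
    have hεn : 0 ≤ ε * ((N : ℝ) + 1) := by positivity
    linarith only [hXsplit, hXrem, hXrem', e4, hsumle, hεn]

end Summit.AtomisticToContinuum.HydrodynamicLimit.Theorems.LambertianContactSwapLambertianEulerCollisionalHeartOfInputs
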